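import Summits.Ventures.LatticeQCDFlow.Scaling.ExactTransportBetweenSteps
import Summits.Ventures.LatticeQCDFlow.Scaling.LatticeGibbs

/-!
# LatticeQCDFlow / Scaling — ENTROPIC TRANSPORT, THE TWO INEQUALITIES: an exact `K`-Lipschitz (`K'`-co-Lipschitz) transport between two Wilson measures lowers (raises) the entropy deficit by at most `#E·(log(A/a) + κ·log K)`

HONEST FRAMING: exact (Metropolis-corrected) sampling algorithms for lattice gauge theory; figures of merit are
autocorrelation/cost numbers at stated couplings and volumes; no continuum-physics claim.

Venture `LatticeQCDFlow` (cell pub-lqcd), topic `Scaling`, FANOUT row 29 (theory-2) — OUR WORK (THEORY-2.md §3.3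
v2.8, the tools behind the entropic transport laws `Scaling/EntropicTransport.lean`).  Write `π = Haar^{⊗E}`,
`μ_β = μ_{Λ,β}` (Wilson measure of a continuous `ρ` with `Re tr ρ ≤ N`, `β ≥ 0`), `D_β = D(μ_β ‖ π)`, and assume
two-sided ball volumes `a·r^κ ≤ Haar(B̄(g,r)) ≤ A·r^κ` (`r ≤ 1` below).  The tree's STEP 1′
(`log_partitionFunction_add_le_between`, `Scaling/ExactTransportBetweenSteps.lean`) is a POINTWISE inequality for an
exact `K`-Lipschitz transport `T_* μ_{β₀} = μ_β`; this file adds its co-Lipschitz twin and INTEGRATES both against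
`μ_{β₀}`, reading the result through the Gibbs identity `D_β = -β⟨S⟩_β - log Z_β` (`gibbsIdentity`,
`Scaling/LatticeGibbs.lean`) and `∫ S∘T dμ_{β₀} = ⟨S⟩_β`:

* `neg_log_partitionFunction_sub_le_between` (STEP 2′): for an exact `K'`-co-Lipschitz `T` (`AntilipschitzWith`;
  measurability follows from exactness, `aemeasurable_of_map_eq_between`),
  `log Z_{β₀} - log Z_β + β₀·S(x) - β·S(Tx) ≤ #E·(log(A/a) + κ·log K')` at every `x`
  (compare `μ_β(B̄(Tx,r)) = μ_{β₀}(T⁻¹B̄(Tx,r)) ≤ μ_{β₀}(B̄(x,K'r))` as `r → 0`);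
* `klDiv_sub_klDiv_le_of_lipschitz`:      `D_{β₀} - D_β ≤ #E·(log(A/a) + κ·log K)`  (exact `K`-Lipschitz `T`);
* `klDiv_sub_klDiv_le_of_antilipschitz`:  `D_β - D_{β₀} ≤ #E·(log(A/a) + κ·log K')` (exact `K'`-co-Lipschitz `T`);

valid for EVERY pair `β₀, β ≥ 0` in either order and every volume — the metric-measure form of
`h(TX) ≤ h(X) + dim·log Lip(T)` on the `κ·#E`-dimensional configuration space, with no smoothness or injectivity
assumed.  Also: `μ_{Λ,β}` is a probability measure (`isProbabilityMeasure_wilsonMeasure_of_le`) and an exact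
Lipschitz transport between couplings has `Lip > 0` (`lipschitz_pos_of_map_eq_between`).  Elementary given the tree; nothing here is cited as a fact.  Reading:
Cover–Thomas, *Elements of Information Theory* 2nd ed., Thm 8.6.4 (`h(AX) = h(X) + log|det A|`); Villani, *Topics in
Optimal Transportation* (2003) §6.
-/

noncomputable section

namespace Summit.Ventures.LatticeQCDFlow.Theory2.Lattice

open MeasureTheory InformationTheory Metric Set Literature.MathematicalPhysics.QuantumFieldTheory

/-! ## §1. Tools: the Wilson measure is a probability measure; exactness forces a.e.-measurability; STEP 2′;
the two entropic inequalities -/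

section Tools

variable {N : ℕ} {G : Type} [Group G] [MetricSpace G] [IsTopologicalGroup G] [CompactSpace G]
  [MeasurableSpace G] [BorelSpace G] (ρ : G →* Matrix (Fin N) (Fin N) ℂ)

/-- `μ_{Λ,β}` is a probability measure (`β ≥ 0`, continuous `ρ` with `Re tr ρ ≤ N`, so `0 < Z_Λ(β) ≤ 1`).
[folklore] -/
theorem isProbabilityMeasure_wilsonMeasure_of_le {d L : ℕ} [NeZero L]
    (hρ : Continuous (ρ : G → Matrix (Fin N) (Fin N) ℂ)) (htr : ∀ g, (ρ g).trace.re ≤ N) {β : ℝ} (hβ : 0 ≤ β) :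
    IsProbabilityMeasure (wilsonMeasure (d := d) (L := L) ρ β) :=
  ⟨by
    show ((partitionFunction ρ β)⁻¹ • wilsonWeight ρ β) univ = 1
    rw [Measure.smul_apply, smul_eq_mul]
    exact ENNReal.inv_mul_cancel (partitionFunction_ne_zero ρ hρ β)
      (ne_top_of_le_ne_top ENNReal.one_ne_top (partitionFunction_le_one ρ htr hβ))⟩

/-- **Exactness between couplings forces a.e.-measurability**: if `T_* μ_{Λ,β₀} = μ_{Λ,β}` (Mathlib's
`Measure.map`) then `T` is `μ_{Λ,β₀}`-a.e. measurable — otherwise `Measure.map T μ_{Λ,β₀} = 0 ≠ μ_{Λ,β}`.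
[folklore] -/
theorem aemeasurable_of_map_eq_between {d L : ℕ} [NeZero L]
    (hρ : Continuous (ρ : G → Matrix (Fin N) (Fin N) ℂ)) (htr : ∀ g, (ρ g).trace.re ≤ N) {β₀ β : ℝ} (hβ : 0 ≤ β)
    {T : GaugeConfig d L G → GaugeConfig d L G}
    (hmap : (wilsonMeasure (d := d) (L := L) ρ β₀).map T = wilsonMeasure (d := d) (L := L) ρ β) :
    AEMeasurable T (wilsonMeasure (d := d) (L := L) ρ β₀) := by
  by_contra h
  haveI := isProbabilityMeasure_wilsonMeasure_of_le (d := d) (L := L) ρ hρ htr hβ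
  have h1 : wilsonMeasure (d := d) (L := L) ρ β univ = 1 := measure_univ
  rw [← hmap, Measure.map_of_not_aemeasurable h] at h1
  simp at h1

/-- **STEP 2′ — the co-Lipschitz density-ratio step between couplings**: for an exact `K'`-co-Lipschitz transport
`T` of `μ_{Λ,β₀}` onto `μ_{Λ,β}` (`K' > 0`, `β₀, β ≥ 0`; measurability from exactness) and two-sided ball volumes,
`log Z_Λ(β₀) - log Z_Λ(β) + β₀·S(x) - β·S(Tx) ≤ #E·(log(A/a) + κ·log K')` at every `x` (compare
`μ_β(B̄(Tx,r)) = μ_{β₀}(T⁻¹B̄(Tx,r)) ≤ μ_{β₀}(B̄(x,K'r))` as `r → 0`). [folklore] -/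
theorem neg_log_partitionFunction_sub_le_between {d L : ℕ} [NeZero L]
    (hρ : Continuous (ρ : G → Matrix (Fin N) (Fin N) ℂ)) (htr : ∀ g, (ρ g).trace.re ≤ N)
    {κ : ℕ} {a A : ℝ} (ha : 0 < a) (hA : 0 < A)
    (hlo : ∀ (g : G) (r : ℝ), 0 < r → r ≤ 1 → a * r ^ κ ≤ (haarProbability G (closedBall g r)).toReal)
    (hup : ∀ (g : G) (r : ℝ), 0 < r → (haarProbability G (closedBall g r)).toReal ≤ A * r ^ κ)
    {β₀ β : ℝ} (hβ₀ : 0 ≤ β₀) (hβ0 : 0 ≤ β) {T : GaugeConfig d L G → GaugeConfig d L G} {K' : NNReal}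
    (hK'0 : 0 < (K' : ℝ)) (hT' : AntilipschitzWith K' T)
    (hmap : (wilsonMeasure (d := d) (L := L) ρ β₀).map T = wilsonMeasure (d := d) (L := L) ρ β)
    (x : GaugeConfig d L G) :
    Real.log (partitionFunction (d := d) (L := L) ρ β₀).toReal -
        Real.log (partitionFunction (d := d) (L := L) ρ β).toReal +
        β₀ * wilsonAction ρ x - β * wilsonAction ρ (T x) ≤
      Fintype.card (Edge d L) * (Real.log (A / a) + κ * Real.log K') := by
  set π : Measure (GaugeConfig d L G) := Measure.pi fun _ : Edge d L => haarProbability G with hπ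
  set S : GaugeConfig d L G → ℝ := wilsonAction (d := d) (L := L) ρ with hSdef
  have hScont : Continuous S := continuous_wilsonAction (d := d) (L := L) ρ hρ
  have hTm : AEMeasurable T (wilsonMeasure (d := d) (L := L) ρ β₀) :=
    aemeasurable_of_map_eq_between ρ hρ htr hβ0 hmap
  set nE : ℕ := Fintype.card (Edge d L) with hnE
  have hZ0 : partitionFunction (d := d) (L := L) ρ β ≠ 0 := partitionFunction_ne_zero ρ hρ β
  have hZtop : partitionFunction (d := d) (L := L) ρ β ≠ ⊤ :=
    ne_top_of_le_ne_top ENNReal.one_ne_top (partitionFunction_le_one ρ htr hβ0)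
  set Z : ℝ := (partitionFunction (d := d) (L := L) ρ β).toReal with hZdef
  have hZpos : 0 < Z := ENNReal.toReal_pos hZ0 hZtop
  have hZ₀0 : partitionFunction (d := d) (L := L) ρ β₀ ≠ 0 := partitionFunction_ne_zero ρ hρ β₀
  have hZ₀top : partitionFunction (d := d) (L := L) ρ β₀ ≠ ⊤ :=
    ne_top_of_le_ne_top ENNReal.one_ne_top (partitionFunction_le_one ρ htr hβ₀)
  set Z₀ : ℝ := (partitionFunction (d := d) (L := L) ρ β₀).toReal with hZ₀def
  have hZ₀pos : 0 < Z₀ := ENNReal.toReal_pos hZ₀0 hZ₀top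
  have hμT : ∀ B : Set (GaugeConfig d L G), MeasurableSet B →
      wilsonMeasure (d := d) (L := L) ρ β B = wilsonMeasure (d := d) (L := L) ρ β₀ (T ⁻¹' B) := fun B hB => by
    rw [← hmap, Measure.map_apply_of_aemeasurable hTm hB]
  have hμW : ∀ (β' : ℝ) (B : Set (GaugeConfig d L G)),
      wilsonMeasure (d := d) (L := L) ρ β' B = (partitionFunction ρ β')⁻¹ * wilsonWeight ρ β' B := fun β' B => by
    show ((partitionFunction ρ β')⁻¹ • wilsonWeight ρ β') B = _
    rw [Measure.smul_apply, smul_eq_mul]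
  refine le_of_forall_pos_le_add fun ε hε => ?_
  have hε' : 0 < ε / (β + β₀ + 1) := by positivity
  have hβε : (β + β₀) * (ε / (β + β₀ + 1)) ≤ ε := by
    rw [mul_div_assoc', div_le_iff₀ (by positivity)]; nlinarith
  obtain ⟨δ₁, hδ₁, hδ₁S⟩ := Metric.continuous_iff.1 hScont (T x) (ε / (β + β₀ + 1)) hε'
  obtain ⟨δ₀, hδ₀, hδ₀S⟩ := Metric.continuous_iff.1 hScont x (ε / (β + β₀ + 1)) hε'
  set r : ℝ := min (min 1 (δ₁ / 2)) (δ₀ / (2 * K')) with hr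
  have hr0 : 0 < r := lt_min (lt_min one_pos (by positivity)) (by positivity)
  have hr1 : r ≤ 1 := (min_le_left _ _).trans (min_le_left _ _)
  have hrδ₁ : r < δ₁ := lt_of_le_of_lt ((min_le_left _ _).trans (min_le_right _ _)) (by linarith)
  have hK'r : K' * r < δ₀ := by
    have : r ≤ δ₀ / (2 * K') := min_le_right _ _
    calc (K' : ℝ) * r ≤ K' * (δ₀ / (2 * K')) := mul_le_mul_of_nonneg_left this hK'0.le
      _ = δ₀ / 2 := by field_simp
      _ < δ₀ := by linarith
  -- (i) `Z⁻¹ e^{-β(S(Tx) + ε')} (a r^κ)^{nE} ≤ μ(B̄(Tx, r))`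
  have h1 := pow_le_pi_closedBall ha.le hlo (T x) hr0 hr1
  have hSB : ∀ U ∈ closedBall (T x) r, S U ≤ S (T x) + ε / (β + β₀ + 1) := fun U hU => by
    have hd : dist U (T x) < δ₁ := lt_of_le_of_lt (mem_closedBall.1 hU) hrδ₁
    have := hδ₁S U hd
    rw [Real.dist_eq] at this
    linarith [(abs_lt.1 this).2]
  have h3 := le_wilsonWeight_of_le ρ hβ0 measurableSet_closedBall hSB
  -- (ii) `μ(B̄(Tx, r)) = μ₀(T⁻¹ B̄(Tx, r)) ≤ μ₀(B̄(x, K' r))`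
  have hsub : T ⁻¹' closedBall (T x) r ⊆ closedBall x (K' * r) := fun u hu => by
    rw [mem_preimage, mem_closedBall] at hu
    rw [mem_closedBall]
    exact (hT'.le_mul_dist u x).trans (mul_le_mul_of_nonneg_left hu K'.coe_nonneg)
  have h2 : wilsonMeasure (d := d) (L := L) ρ β (closedBall (T x) r) ≤
      wilsonMeasure (d := d) (L := L) ρ β₀ (closedBall x (K' * r)) := by
    rw [hμT _ measurableSet_closedBall]; exact measure_mono hsub
  -- (iii) `μ₀(B̄(x, K' r)) ≤ Z₀⁻¹ e^{-β₀(S x - ε')} (A (K' r)^κ)^{nE}`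
  have hSB₀ : ∀ U ∈ closedBall x (K' * r), S x - ε / (β + β₀ + 1) ≤ S U := fun U hU => by
    have hd : dist U x < δ₀ := lt_of_le_of_lt (mem_closedBall.1 hU) hK'r
    have := hδ₀S U hd
    rw [Real.dist_eq] at this
    linarith [(abs_lt.1 this).1]
  have h3₀ := wilsonWeight_le_of_le ρ hβ₀ measurableSet_closedBall hSB₀
  have h4 := pi_closedBall_le_pow hup x (mul_pos hK'0 hr0)
  have hfin : (partitionFunction (d := d) (L := L) ρ β₀)⁻¹ *
      (ENNReal.ofReal (Real.exp (-(β₀ * (S x - ε / (β + β₀ + 1))))) * π (closedBall x (K' * r))) ≠ ⊤ :=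
    ENNReal.mul_ne_top (ENNReal.inv_ne_top.2 hZ₀0) (ENNReal.mul_ne_top ENNReal.ofReal_ne_top (measure_ne_top _ _))
  have h5 : (partitionFunction (d := d) (L := L) ρ β)⁻¹ *
        (ENNReal.ofReal (Real.exp (-(β * (S (T x) + ε / (β + β₀ + 1))))) * π (closedBall (T x) r)) ≤
      (partitionFunction (d := d) (L := L) ρ β₀)⁻¹ *
        (ENNReal.ofReal (Real.exp (-(β₀ * (S x - ε / (β + β₀ + 1))))) * π (closedBall x (K' * r))) :=
    calc _ ≤ wilsonMeasure (d := d) (L := L) ρ β (closedBall (T x) r) := by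
          rw [hμW]; exact mul_le_mul' le_rfl h3
      _ ≤ wilsonMeasure (d := d) (L := L) ρ β₀ (closedBall x (K' * r)) := h2
      _ ≤ _ := by rw [hμW]; exact mul_le_mul' le_rfl h3₀
  have h6 := ENNReal.toReal_mono hfin h5
  rw [ENNReal.toReal_mul, ENNReal.toReal_mul, ENNReal.toReal_mul, ENNReal.toReal_mul, ENNReal.toReal_inv,
    ENNReal.toReal_inv, ENNReal.toReal_ofReal (Real.exp_pos _).le, ENNReal.toReal_ofReal (Real.exp_pos _).le]
    at h6
  have h7 : Z⁻¹ * (Real.exp (-(β * (S (T x) + ε / (β + β₀ + 1)))) * (a * r ^ κ) ^ nE) ≤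
      Z₀⁻¹ * (Real.exp (-(β₀ * (S x - ε / (β + β₀ + 1)))) * (A * (K' * r) ^ κ) ^ nE) :=
    calc Z⁻¹ * (Real.exp (-(β * (S (T x) + ε / (β + β₀ + 1)))) * (a * r ^ κ) ^ nE)
        ≤ Z⁻¹ * (Real.exp (-(β * (S (T x) + ε / (β + β₀ + 1)))) * (π (closedBall (T x) r)).toReal) :=
          mul_le_mul_of_nonneg_left (mul_le_mul_of_nonneg_left h1 (Real.exp_pos _).le)
            (inv_nonneg.2 hZpos.le)
      _ ≤ Z₀⁻¹ * (Real.exp (-(β₀ * (S x - ε / (β + β₀ + 1)))) * (π (closedBall x (K' * r))).toReal) := h6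
      _ ≤ Z₀⁻¹ * (Real.exp (-(β₀ * (S x - ε / (β + β₀ + 1)))) * (A * (K' * r) ^ κ) ^ nE) :=
          mul_le_mul_of_nonneg_left (mul_le_mul_of_nonneg_left h4 (Real.exp_pos _).le)
            (inv_nonneg.2 hZ₀pos.le)
  have hlhs : 0 < Z⁻¹ * (Real.exp (-(β * (S (T x) + ε / (β + β₀ + 1)))) * (a * r ^ κ) ^ nE) := by positivity
  have h8 := Real.log_le_log hlhs h7
  rw [Real.log_mul (inv_pos.2 hZpos).ne' (by positivity), Real.log_inv,
    Real.log_mul (Real.exp_pos _).ne' (by positivity), Real.log_exp, Real.log_pow,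
    Real.log_mul ha.ne' (pow_pos hr0 _).ne', Real.log_pow,
    Real.log_mul (inv_pos.2 hZ₀pos).ne' (by positivity), Real.log_inv,
    Real.log_mul (Real.exp_pos _).ne' (by positivity), Real.log_exp, Real.log_pow,
    Real.log_mul hA.ne' (by positivity), Real.log_pow, Real.log_mul hK'0.ne' hr0.ne'] at h8
  rw [Real.log_div hA.ne' ha.ne']
  linarith only [h8, hβε]

/-- **THE ENTROPIC INEQUALITY, LIPSCHITZ SIDE** (OURS): for an exact `K`-Lipschitz transport `T` of `μ_{Λ,β₀}` onto
`μ_{Λ,β}` (`K > 0`; `β₀, β ≥ 0` in either order) and two-sided ball volumes,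
`D(μ_{Λ,β₀} ‖ Haar^{⊗E}) - D(μ_{Λ,β} ‖ Haar^{⊗E}) ≤ #E·(log(A/a) + κ·log K)`: a Lipschitz map lowers the entropy
deficit by at most `dim·log Lip` (plus the ball-volume constant).  Proof: integrate STEP 1′
(`log_partitionFunction_add_le_between`) against `μ_{β₀}`, use `∫ S∘T dμ_{β₀} = ⟨S⟩_β` and the Gibbs identity.
[folklore] -/
theorem klDiv_sub_klDiv_le_of_lipschitz {d L : ℕ} [NeZero L] [SecondCountableTopology G]
    (hρ : Continuous (ρ : G → Matrix (Fin N) (Fin N) ℂ)) (htr : ∀ g, (ρ g).trace.re ≤ N)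
    {κ : ℕ} {a A : ℝ} (ha : 0 < a) (hA : 0 < A)
    (hlo : ∀ (g : G) (r : ℝ), 0 < r → r ≤ 1 → a * r ^ κ ≤ (haarProbability G (closedBall g r)).toReal)
    (hup : ∀ (g : G) (r : ℝ), 0 < r → (haarProbability G (closedBall g r)).toReal ≤ A * r ^ κ)
    {β₀ β : ℝ} (hβ₀ : 0 ≤ β₀) (hβ0 : 0 ≤ β) {T : GaugeConfig d L G → GaugeConfig d L G} {K : NNReal}
    (hK0 : 0 < (K : ℝ)) (hT : LipschitzWith K T)
    (hmap : (wilsonMeasure (d := d) (L := L) ρ β₀).map T = wilsonMeasure (d := d) (L := L) ρ β) :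
    (klDiv (wilsonMeasure (d := d) (L := L) ρ β₀) (Measure.pi fun _ : Edge d L => haarProbability G)).toReal -
        (klDiv (wilsonMeasure (d := d) (L := L) ρ β) (Measure.pi fun _ : Edge d L => haarProbability G)).toReal ≤
      Fintype.card (Edge d L) * (Real.log (A / a) + κ * Real.log K) := by
  have hScont : Continuous (wilsonAction (d := d) (L := L) ρ) := continuous_wilsonAction (d := d) (L := L) ρ hρ
  haveI := isProbabilityMeasure_wilsonMeasure_of_le (d := d) (L := L) ρ hρ htr hβ₀
  rw [gibbsIdentity d N G ρ hρ htr L β₀ hβ₀, gibbsIdentity d N G ρ hρ htr L β hβ0]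
  have hpt := log_partitionFunction_add_le_between ρ hρ htr ha hA hlo hup hβ₀ hβ0 hK0 hT hmap
  obtain ⟨C, hC⟩ := isCompact_univ.exists_bound_of_continuousOn (hScont.continuousOn (s := univ))
  have hSint : Integrable (wilsonAction (d := d) (L := L) ρ) (wilsonMeasure (d := d) (L := L) ρ β₀) :=
    Integrable.of_bound hScont.aestronglyMeasurable C (ae_of_all _ fun U => hC U (mem_univ U))
  have hSTint : Integrable (fun x => wilsonAction (d := d) (L := L) ρ (T x)) (wilsonMeasure (d := d) (L := L) ρ β₀) :=
    Integrable.of_bound (hScont.comp hT.continuous).aestronglyMeasurable C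
      (ae_of_all _ fun U => hC (T U) (mem_univ _))
  have hE : wilsonExpectation (d := d) (L := L) ρ β (wilsonAction (d := d) (L := L) ρ) =
      ∫ x, wilsonAction (d := d) (L := L) ρ (T x) ∂(wilsonMeasure (d := d) (L := L) ρ β₀) := by
    unfold wilsonExpectation
    rw [← hmap, integral_map hT.continuous.measurable.aemeasurable hScont.aestronglyMeasurable]
  have hE₀ : wilsonExpectation (d := d) (L := L) ρ β₀ (wilsonAction (d := d) (L := L) ρ) =
      ∫ x, wilsonAction (d := d) (L := L) ρ x ∂(wilsonMeasure (d := d) (L := L) ρ β₀) := rfl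
  set M : ℝ := Fintype.card (Edge d L) * (Real.log (A / a) + κ * Real.log K) with hM
  set lZ : ℝ := Real.log (partitionFunction (d := d) (L := L) ρ β).toReal with hlZ
  set lZ₀ : ℝ := Real.log (partitionFunction (d := d) (L := L) ρ β₀).toReal with hlZ₀
  have hI : ∫ x, (β * wilsonAction (d := d) (L := L) ρ (T x) - β₀ * wilsonAction (d := d) (L := L) ρ x)
        ∂(wilsonMeasure (d := d) (L := L) ρ β₀) ≤
      ∫ _x, (M - lZ + lZ₀) ∂(wilsonMeasure (d := d) (L := L) ρ β₀) :=
    integral_mono ((hSTint.const_mul β).sub (hSint.const_mul β₀)) (integrable_const _) fun x => by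
      have := hpt x
      show β * wilsonAction ρ (T x) - β₀ * wilsonAction ρ x ≤ M - lZ + lZ₀
      linarith
  have h1 : ∫ x, (β * wilsonAction (d := d) (L := L) ρ (T x) - β₀ * wilsonAction (d := d) (L := L) ρ x)
        ∂(wilsonMeasure (d := d) (L := L) ρ β₀) =
      β * wilsonExpectation (d := d) (L := L) ρ β (wilsonAction (d := d) (L := L) ρ) -
        β₀ * wilsonExpectation (d := d) (L := L) ρ β₀ (wilsonAction (d := d) (L := L) ρ) := by
    rw [integral_sub (hSTint.const_mul β) (hSint.const_mul β₀), integral_const_mul, integral_const_mul, hE, hE₀]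
  have h2 : ∫ _x, (M - lZ + lZ₀) ∂(wilsonMeasure (d := d) (L := L) ρ β₀) = M - lZ + lZ₀ := by
    rw [integral_const, probReal_univ, one_smul]
  linarith [hI, h1, h2]

/-- **THE ENTROPIC INEQUALITY, CO-LIPSCHITZ SIDE** (OURS): for an exact `K'`-co-Lipschitz transport `T` of
`μ_{Λ,β₀}` onto `μ_{Λ,β}` (`K' > 0`; `β₀, β ≥ 0` in either order; measurability from exactness) and two-sided ball
volumes, `D(μ_{Λ,β} ‖ Haar^{⊗E}) - D(μ_{Λ,β₀} ‖ Haar^{⊗E}) ≤ #E·(log(A/a) + κ·log K')`: a co-Lipschitz map raises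
the entropy deficit by at most `dim·log coLip`.  Proof: integrate STEP 2′ against `μ_{β₀}`. [folklore] -/
theorem klDiv_sub_klDiv_le_of_antilipschitz {d L : ℕ} [NeZero L] [SecondCountableTopology G]
    (hρ : Continuous (ρ : G → Matrix (Fin N) (Fin N) ℂ)) (htr : ∀ g, (ρ g).trace.re ≤ N)
    {κ : ℕ} {a A : ℝ} (ha : 0 < a) (hA : 0 < A)
    (hlo : ∀ (g : G) (r : ℝ), 0 < r → r ≤ 1 → a * r ^ κ ≤ (haarProbability G (closedBall g r)).toReal)
    (hup : ∀ (g : G) (r : ℝ), 0 < r → (haarProbability G (closedBall g r)).toReal ≤ A * r ^ κ)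
    {β₀ β : ℝ} (hβ₀ : 0 ≤ β₀) (hβ0 : 0 ≤ β) {T : GaugeConfig d L G → GaugeConfig d L G} {K' : NNReal}
    (hK'0 : 0 < (K' : ℝ)) (hT' : AntilipschitzWith K' T)
    (hmap : (wilsonMeasure (d := d) (L := L) ρ β₀).map T = wilsonMeasure (d := d) (L := L) ρ β) :
    (klDiv (wilsonMeasure (d := d) (L := L) ρ β) (Measure.pi fun _ : Edge d L => haarProbability G)).toReal -
        (klDiv (wilsonMeasure (d := d) (L := L) ρ β₀) (Measure.pi fun _ : Edge d L => haarProbability G)).toReal ≤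
      Fintype.card (Edge d L) * (Real.log (A / a) + κ * Real.log K') := by
  have hScont : Continuous (wilsonAction (d := d) (L := L) ρ) := continuous_wilsonAction (d := d) (L := L) ρ hρ
  haveI := isProbabilityMeasure_wilsonMeasure_of_le (d := d) (L := L) ρ hρ htr hβ₀
  have hTm : AEMeasurable T (wilsonMeasure (d := d) (L := L) ρ β₀) :=
    aemeasurable_of_map_eq_between ρ hρ htr hβ0 hmap
  rw [gibbsIdentity d N G ρ hρ htr L β₀ hβ₀, gibbsIdentity d N G ρ hρ htr L β hβ0]
  have hpt := neg_log_partitionFunction_sub_le_between ρ hρ htr ha hA hlo hup hβ₀ hβ0 hK'0 hT' hmap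
  obtain ⟨C, hC⟩ := isCompact_univ.exists_bound_of_continuousOn (hScont.continuousOn (s := univ))
  have hSint : Integrable (wilsonAction (d := d) (L := L) ρ) (wilsonMeasure (d := d) (L := L) ρ β₀) :=
    Integrable.of_bound hScont.aestronglyMeasurable C (ae_of_all _ fun U => hC U (mem_univ U))
  have hSTint : Integrable (fun x => wilsonAction (d := d) (L := L) ρ (T x)) (wilsonMeasure (d := d) (L := L) ρ β₀) :=
    Integrable.of_bound (hScont.measurable.comp_aemeasurable hTm).aestronglyMeasurable C
      (ae_of_all _ fun U => hC (T U) (mem_univ _))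
  have hE : wilsonExpectation (d := d) (L := L) ρ β (wilsonAction (d := d) (L := L) ρ) =
      ∫ x, wilsonAction (d := d) (L := L) ρ (T x) ∂(wilsonMeasure (d := d) (L := L) ρ β₀) := by
    unfold wilsonExpectation
    rw [← hmap, integral_map hTm hScont.aestronglyMeasurable]
  have hE₀ : wilsonExpectation (d := d) (L := L) ρ β₀ (wilsonAction (d := d) (L := L) ρ) =
      ∫ x, wilsonAction (d := d) (L := L) ρ x ∂(wilsonMeasure (d := d) (L := L) ρ β₀) := rfl
  set M : ℝ := Fintype.card (Edge d L) * (Real.log (A / a) + κ * Real.log K') with hM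
  set lZ : ℝ := Real.log (partitionFunction (d := d) (L := L) ρ β).toReal with hlZ
  set lZ₀ : ℝ := Real.log (partitionFunction (d := d) (L := L) ρ β₀).toReal with hlZ₀
  have hI : ∫ x, (β₀ * wilsonAction (d := d) (L := L) ρ x - β * wilsonAction (d := d) (L := L) ρ (T x))
        ∂(wilsonMeasure (d := d) (L := L) ρ β₀) ≤
      ∫ _x, (M - lZ₀ + lZ) ∂(wilsonMeasure (d := d) (L := L) ρ β₀) :=
    integral_mono ((hSint.const_mul β₀).sub (hSTint.const_mul β)) (integrable_const _) fun x => by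
      have := hpt x
      show β₀ * wilsonAction ρ x - β * wilsonAction ρ (T x) ≤ M - lZ₀ + lZ
      linarith
  have h1 : ∫ x, (β₀ * wilsonAction (d := d) (L := L) ρ x - β * wilsonAction (d := d) (L := L) ρ (T x))
        ∂(wilsonMeasure (d := d) (L := L) ρ β₀) =
      β₀ * wilsonExpectation (d := d) (L := L) ρ β₀ (wilsonAction (d := d) (L := L) ρ) -
        β * wilsonExpectation (d := d) (L := L) ρ β (wilsonAction (d := d) (L := L) ρ) := by
    rw [integral_sub (hSint.const_mul β₀) (hSTint.const_mul β), integral_const_mul, integral_const_mul, hE, hE₀]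
  have h2 : ∫ _x, (M - lZ₀ + lZ) ∂(wilsonMeasure (d := d) (L := L) ρ β₀) = M - lZ₀ + lZ := by
    rw [integral_const, probReal_univ, one_smul]
  linarith [hI, h1, h2]

/-- An exact LIPSCHITZ transport between couplings has a positive Lipschitz constant: its image meets the two
disjoint balls of radius `dist(V₁, 1)/2` about `1` and about a constant configuration `V₁ ≠ 1` (`μ_{Λ,β}` charges
open sets; a non-trivial `g₁ ∈ G` exists by the upper ball volume, `κ ≥ 1`; an edge exists for `d ≥ 1`). [folklore] -/
theorem lipschitz_pos_of_map_eq_between {d L : ℕ} [NeZero L] [SecondCountableTopology G] (hd : 1 ≤ d)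
    (htr : ∀ g, (ρ g).trace.re ≤ N) (htr' : ∀ g, -(N : ℝ) ≤ (ρ g).trace.re)
    {κ : ℕ} (hκ : 0 < κ) {A : ℝ} (hA : 0 < A)
    (hup : ∀ (g : G) (r : ℝ), 0 < r → (haarProbability G (closedBall g r)).toReal ≤ A * r ^ κ)
    {β₀ β : ℝ} (hβ0 : 0 ≤ β) {T : GaugeConfig d L G → GaugeConfig d L G} {K : NNReal} (hT : LipschitzWith K T)
    (hmap : (wilsonMeasure (d := d) (L := L) ρ β₀).map T = wilsonMeasure (d := d) (L := L) ρ β) :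
    0 < (K : ℝ) := by
  obtain ⟨g₁, hg₁⟩ := exists_ne_one_of_ballVolumes hκ hA hup
  set e₀ : Edge d L := (fun _ => 0, ⟨0, hd⟩) with he₀
  set V₁ : GaugeConfig d L G := fun _ => g₁ with hV₁
  have hne : V₁ ≠ (1 : GaugeConfig d L G) := fun h => hg₁ (by
    have := congr_fun h e₀
    simpa [hV₁] using this)
  have hpos : 0 < dist V₁ (1 : GaugeConfig d L G) := dist_pos.2 hne
  set δ : ℝ := dist V₁ (1 : GaugeConfig d L G) / 2 with hδ
  have hδ0 : 0 < δ := by positivity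
  have hTm : Measurable T := hT.continuous.measurable
  obtain ⟨x₁, hx₁⟩ := exists_apply_mem_of_map_eq_between ρ htr htr' hβ0 hTm hmap isOpen_ball
    ⟨V₁, mem_ball_self hδ0⟩
  obtain ⟨x₀, hx₀⟩ := exists_apply_mem_of_map_eq_between ρ htr htr' hβ0 hTm hmap isOpen_ball
    ⟨(1 : GaugeConfig d L G), mem_ball_self hδ0⟩
  have hx₁' : dist (T x₁) V₁ < δ := mem_ball.1 hx₁
  have hx₀' : dist (T x₀) 1 < δ := mem_ball.1 hx₀
  have hne' : T x₁ ≠ T x₀ := fun h => by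
    have htri := dist_triangle V₁ (T x₁) (1 : GaugeConfig d L G)
    rw [dist_comm] at hx₁'
    rw [h] at htri hx₁'
    linarith
  have h1 := hT.dist_le_mul x₁ x₀
  have hp : 0 < dist (T x₁) (T x₀) := dist_pos.2 hne'
  rcases K.coe_nonneg.eq_or_lt with h | h
  · rw [← h, zero_mul] at h1; linarith
  · exact h

end Tools

end Summit.Ventures.LatticeQCDFlow.Theory2.Lattice
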